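import Literature.Geometry.Riemannian.PeriodicNormalFrame
import Literature.Geometry.Riemannian.FramedExponentialMap
import Literature.Geometry.Manifold.PeriodicTubeInjectivity
import HarnessLib

/-!
# The tubular map of a closed curve: `(θ, x) ↦ exp_{γ θ}(∑ xₐ νₐ(θ))`

Topic `Literature/Geometry/Riemannian`.  Let `γ : ℝ → M` be a `C^∞`, regular, `T`-periodic curve,
injective modulo `T`, in an oriented Riemannian `4`-manifold (no boundary) with a metric-compatible
`C^∞` connection `cov`.  With the `T`-periodic orthonormal frame `ν₀ = γ'/|γ'|, ν₁, ν₂, ν₃` of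
`PeriodicNormalFrame.exists_periodic_orthonormal_frame`, the **tubular map**

  `χ : ℝ × ℝ³ → M`, `χ(θ, x) = exp_{γ θ}(x₁ ν₁(θ) + x₂ ν₂(θ) + x₃ ν₃(θ))`

is `T`-periodic in `θ`, restricts to `γ` on the axis, has differential
`dχ_{(θ,0)}(c, u) = c γ'(θ) + ∑ uₐ ν_{a}(θ)` there, and on a UNIFORM tube `ℝ × B(0, r)` it is
`C^∞` with injective differential and injective modulo `T` (`exists_periodic_tubularMap`) — the
tubular neighbourhood theorem for an embedded circle in the form "immersion of the solid torus,
an embedding of `(ℝ/Tℤ) × B³`" (Lee, *Introduction to Riemannian Manifolds* (2018), Thm. 5.25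
(normal exponential map `E`, uniform tubular neighbourhoods of compact submanifolds); Hirsch,
*Differential Topology* (1976), Ch. 4, §5, Thm. 5.2).  Ingredients: the framed exponential map
(`FramedExponentialMap.lean`: smooth, local diffeomorphism along the zero section), injectivity
modulo the period on a uniform tube (`PeriodicTubeInjectivity.lean`), the generalized tube lemma
over `[0, T]`, and translation by periods.  Everything is proved; no definitions, no named facts.

## References

* J. M. Lee, *Introduction to Riemannian Manifolds*, 2nd ed., GTM 176 (2018), Thm. 5.25,
  Prop. 5.26. [LeeRiemannianManifolds2018]
* M. W. Hirsch, *Differential Topology*, GTM 33 (1976), Ch. 4, §5, Thm. 5.2. [HirschDT1976]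
-/

noncomputable section

open Bundle Set Filter Function Module Metric
open scoped Manifold ContDiff Topology

namespace Literature.Geometry.Riemannian

open Literature.Geometry.Lorentzian Literature.Topology.FourManifolds Literature.Geometry.Manifold

variable {E : Type*} [NormedAddCommGroup E] [NormedSpace ℝ E] [FiniteDimensional ℝ E]
  [CompleteSpace E] {H : Type*} [TopologicalSpace H] {I : ModelWithCorners ℝ E H}
  [I.Boundaryless] {M : Type*} [TopologicalSpace M] [ChartedSpace H M] [IsManifold I ∞ M]
  [T2Space M] [BoundarylessManifold I M]
  {cov : CovariantDerivative I E (TangentSpace I : M → Type _)}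
  [CovariantDerivative.ContMDiffCovariantDerivative cov 1]
  [CovariantDerivative.ContMDiffCovariantDerivative cov (⊤ : ℕ∞)]
  (g : PseudoRiemannianMetric I ∞ E (TangentSpace I : M → Type _))

/-- **Translation by a period in the parameter is a diffeomorphism of `ℝ × ℝ³`**, hence a local
diffeomorphism at every point. [folklore] -/
theorem isLocalDiffeomorphAt_translate (c : ℝ) (q : ℝ × (Fin 3 → ℝ)) :
    IsLocalDiffeomorphAt (𝓘(ℝ, ℝ).prod 𝓘(ℝ, (Fin 3 → ℝ))) (𝓘(ℝ, ℝ).prod 𝓘(ℝ, (Fin 3 → ℝ))) ∞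
      (fun q : ℝ × (Fin 3 → ℝ) ↦ (q.1 + c, q.2)) q := by
  set Φ : Diffeomorph (𝓘(ℝ, ℝ).prod 𝓘(ℝ, (Fin 3 → ℝ))) (𝓘(ℝ, ℝ).prod 𝓘(ℝ, (Fin 3 → ℝ)))
      (ℝ × (Fin 3 → ℝ)) (ℝ × (Fin 3 → ℝ)) ∞ :=
    { toFun := fun q ↦ (q.1 + c, q.2)
      invFun := fun q ↦ (q.1 - c, q.2)
      left_inv := fun q ↦ by simp
      right_inv := fun q ↦ by simp
      contMDiff_toFun := (contMDiff_fst.add contMDiff_const).prodMk contMDiff_snd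
      contMDiff_invFun := (contMDiff_fst.sub contMDiff_const).prodMk contMDiff_snd } with hΦ
  exact Φ.isLocalDiffeomorph q

/-- **The tubular map of a closed curve** (Lee 2018, Thm. 5.25; Hirsch 1976, Ch. 4 Thm. 5.2).
For a `C^∞`, regular, `T`-periodic curve `γ`, injective modulo `T`, in an oriented Riemannian
`4`-manifold without boundary with a metric-compatible `C^∞` connection `cov`: there are a
`T`-periodic `C^∞` orthonormal frame `ν₀ = γ'/|γ'|, ν₁, ν₂, ν₃` along `γ` and a radius `r > 0`
such that `χ(θ, x) = exp_{γ θ}(∑ₐ xₐ ν_{a+1}(θ))` is `T`-periodic, equals `γ` on the axis, has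
differential `(c, u) ↦ c γ'(θ) + ∑ uₐ ν_{a+1}(θ)` on the axis, and on the tube `‖x‖ < r` is `C^∞`
with injective differential and injective modulo `T`.
[cite: LeeRiemannianManifolds2018, Thm. 5.25] -/
theorem exists_periodic_tubularMap (hg : g.IsRiemannian) (hcov : g.IsCompatible cov)
    (hreg : cov.IsLocallyContMDiff ∞) (hE : finrank ℝ E = 4) (o : SmoothOrientation I M)
    {γ : ℝ → M} (hγ : ContMDiff 𝓘(ℝ, ℝ) I ∞ γ) {T : ℝ} (hT : 0 < T)
    (hper : ∀ t, γ (t + T) = γ t) (hvel : ∀ t, velocity I γ t ≠ 0)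
    (hinjT : ∀ θ θ' : ℝ, γ θ = γ θ' → ∃ k : ℤ, θ' = θ + k * T) :
    ∃ (ν : Fin 4 → Π t : ℝ, TangentSpace I (γ t)) (r : ℝ),
      (∀ t, ∀ i j, g.val (γ t) (ν i t) (ν j t) = if i = j then 1 else 0) ∧
      (∀ i, ContMDiff 𝓘(ℝ, ℝ) I.tangent ∞
        (fun t ↦ (TotalSpace.mk' E (γ t) (ν i t) : TangentBundle I M))) ∧
      (∀ t, ν 0 t =
        (Real.sqrt (g.val (γ t) (velocity I γ t) (velocity I γ t)))⁻¹ • velocity I γ t) ∧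
      (∀ i t, ν i (t + T) = ν i t) ∧
      0 < r ∧
      (∀ θ (x : (Fin 3 → ℝ)), expMap cov (γ (θ + T)) (∑ a, x a • ν a.succ (θ + T)) =
        expMap cov (γ θ) (∑ a, x a • ν a.succ θ)) ∧
      (∀ θ, expMap cov (γ θ) (∑ a, (0 : (Fin 3 → ℝ)) a • ν a.succ θ) = γ θ) ∧
      (∀ θ (u : ℝ × (Fin 3 → ℝ)), mfderiv (𝓘(ℝ, ℝ).prod 𝓘(ℝ, (Fin 3 → ℝ))) I
        (fun q : ℝ × (Fin 3 → ℝ) ↦ expMap cov (γ q.1) (∑ a, q.2 a • ν a.succ q.1)) (θ, 0) u =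
          u.1 • velocity I γ θ + ∑ a, u.2 a • ν a.succ θ) ∧
      (∀ q : ℝ × (Fin 3 → ℝ), ‖q.2‖ < r →
        ContMDiffAt (𝓘(ℝ, ℝ).prod 𝓘(ℝ, (Fin 3 → ℝ))) I ∞
          (fun q : ℝ × (Fin 3 → ℝ) ↦ expMap cov (γ q.1) (∑ a, q.2 a • ν a.succ q.1)) q ∧
        Injective (mfderiv (𝓘(ℝ, ℝ).prod 𝓘(ℝ, (Fin 3 → ℝ))) I
          (fun q : ℝ × (Fin 3 → ℝ) ↦ expMap cov (γ q.1) (∑ a, q.2 a • ν a.succ q.1)) q)) ∧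
      (∀ θ θ' (x x' : (Fin 3 → ℝ)), ‖x‖ < r → ‖x'‖ < r →
        expMap cov (γ θ) (∑ a, x a • ν a.succ θ) = expMap cov (γ θ') (∑ a, x' a • ν a.succ θ') →
          x = x' ∧ ∃ k : ℤ, θ' = θ + k * T) := by
  classical
  obtain ⟨ν, hon, hsm, hν0, hνper⟩ :=
    exists_periodic_orthonormal_frame g hg hcov hreg hE o hγ hT hper hvel
  -- the linear field `ν̄ θ : ℝ³ →L E`, `ν̄ θ x = ∑ xₐ ν_{a+1} θ`, and the tubular map `χ`
  set νb : Π θ : ℝ, (Fin 3 → ℝ) →L[ℝ] TangentSpace I (γ θ) :=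
    fun θ ↦ ∑ a : Fin 3, (ContinuousLinearMap.proj a : (Fin 3 → ℝ) →L[ℝ] ℝ).smulRight (ν a.succ θ)
    with hνb
  have hνb_apply : ∀ θ (x : (Fin 3 → ℝ)), νb θ x = ∑ a, x a • ν a.succ θ := fun θ x ↦ by
    simp only [hνb, FunLike.coe_sum, Finset.sum_apply, ContinuousLinearMap.smulRight_apply,
      ContinuousLinearMap.proj_apply]
  set χ : ℝ × (Fin 3 → ℝ) → M := fun q ↦ expMap cov (γ q.1) (∑ a, q.2 a • ν a.succ q.1) with hχ
  have hχ_eq : χ = fun q : ℝ × (Fin 3 → ℝ) ↦ expMap cov (γ q.1) (νb q.1 q.2) := by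
    funext q; rw [hχ, hνb_apply]
  -- (1) the field `(θ, x) ↦ (γ θ, ν̄ θ x)` is `C^∞`
  have hfield : ContMDiff (𝓘(ℝ, ℝ).prod 𝓘(ℝ, (Fin 3 → ℝ))) I.tangent ∞
      (fun q : ℝ × (Fin 3 → ℝ) ↦ (TotalSpace.mk' E (γ q.1) (νb q.1 q.2) : TangentBundle I M)) := by
    intro q
    have h := contMDiffAt_totalSpaceMk_sum_smul (I := I) (I' := 𝓘(ℝ, ℝ)) (ι := γ)
      (νs := fun (a : Fin 3) t ↦ ν a.succ t) (hγ q.1) (fun a ↦ hsm a.succ q.1) q.2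
    refine h.congr_of_eventuallyEq (Eventually.of_forall fun q' ↦ ?_)
    show (TotalSpace.mk' E (γ q'.1) (νb q'.1 q'.2) : TangentBundle I M) = _
    rw [hνb_apply]
  have hk : (1 : ℕ∞) ≤ ⊤ := le_top
  -- (2) periodicity and the axis
  have hνb_per : ∀ θ (x : (Fin 3 → ℝ)), (νb (θ + T) x : E) = νb θ x := fun θ x ↦ by
    rw [hνb_apply, hνb_apply]
    exact Finset.sum_congr rfl fun a _ ↦ by rw [hνper]; rfl
  have hχper : ∀ θ (x : (Fin 3 → ℝ)), χ (θ + T, x) = χ (θ, x) := by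
    intro θ x
    have h1 : (TotalSpace.mk' E (γ (θ + T)) (νb (θ + T) x) : TangentBundle I M) =
        TotalSpace.mk' E (γ θ) (νb θ x) := by
      rw [totalSpaceMk_add_period hper, hνb_per]
    show expMap cov (γ (θ + T, x).1) (∑ a, (θ + T, x).2 a • ν a.succ (θ + T, x).1) =
      expMap cov (γ (θ, x).1) (∑ a, (θ, x).2 a • ν a.succ (θ, x).1)
    simp only [← hνb_apply]
    exact congrArg (fun p : TangentBundle I M ↦ expMap cov p.proj p.2) h1
  have hχperZ : ∀ θ (x : (Fin 3 → ℝ)) (k : ℤ), χ (θ + k • T, x) = χ (θ, x) := fun θ x k ↦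
    periodic_zsmul (γ := fun θ ↦ χ (θ, x)) (fun θ ↦ hχper θ x) θ k
  have hχ0 : ∀ θ, χ (θ, 0) = γ θ := fun θ ↦ by
    show expMap cov (γ θ) (∑ a, (0 : (Fin 3 → ℝ)) a • ν a.succ θ) = γ θ
    simp only [Pi.zero_apply, zero_smul, Finset.sum_const_zero]
    exact expMap_zero (cov := cov) (γ θ)
  -- (3) the differential on the axis and the local diffeomorphism property there
  have hvel_eq : ∀ θ (c : ℝ), mfderiv 𝓘(ℝ, ℝ) I γ θ c = c • velocity I γ θ := fun θ c ↦ by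
    conv_lhs => rw [show (c : ℝ) = c • (1 : ℝ) by rw [smul_eq_mul, mul_one]]
    exact map_smul (mfderiv 𝓘(ℝ, ℝ) I γ θ) c (1 : ℝ)
  have hdχ0 : ∀ θ (u : ℝ × (Fin 3 → ℝ)), mfderiv (𝓘(ℝ, ℝ).prod 𝓘(ℝ, (Fin 3 → ℝ))) I χ (θ, 0) u =
      u.1 • velocity I γ θ + ∑ a, u.2 a • ν a.succ θ := fun θ u ↦ by
    rw [hχ_eq, mfderiv_framedExp_zero_apply (cov := cov) hk hfield θ u, hvel_eq, hνb_apply]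
  have hinj0 : ∀ θ, Injective ((mfderiv 𝓘(ℝ, ℝ) I γ θ).coprod (νb θ)) := by
    intro θ
    rw [injective_iff_map_eq_zero]
    rintro ⟨c, x⟩ h
    set c' : ℝ := c with hc'
    rw [ContinuousLinearMap.coprod_apply, hνb_apply] at h
    have h' : c' • velocity I γ θ + ∑ a, x a • ν a.succ θ = 0 := by
      rw [← hvel_eq]; exact h
    -- coefficients in the orthonormal (hence free) frame `ν`
    set sq : ℝ := Real.sqrt (g.val (γ θ) (velocity I γ θ) (velocity I γ θ)) with hsq
    have hsq_pos : 0 < sq := Real.sqrt_pos.2 (hg _ _ (hvel θ))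
    have hv : velocity I γ θ = sq • ν 0 θ := by
      rw [hν0 θ, smul_smul, mul_inv_cancel₀ hsq_pos.ne', one_smul]
    have hli := linearIndependent_of_val_orthonormal g (hon θ)
    set d : Fin 4 → ℝ := Fin.cases (c' * sq) (fun a ↦ x a) with hd
    have hsum : ∑ i, d i • ν i θ = 0 := by
      rw [Fin.sum_univ_succ]
      simp only [hd, Fin.cases_zero, Fin.cases_succ]
      rw [mul_smul, ← hv]
      exact h'
    have hd0 := Fintype.linearIndependent_iff.1 hli d hsum
    have hc : c' = 0 := by
      have h0 : c' * sq = 0 := hd0 0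
      rcases mul_eq_zero.1 h0 with h1 | h1
      · exact h1
      · exact absurd h1 hsq_pos.ne'
    have hx : x = 0 := funext fun a ↦ by simpa [hd] using hd0 a.succ
    exact Prod.ext hc hx
  have hdim : finrank ℝ ℝ + finrank ℝ (Fin 3 → ℝ) = finrank ℝ E := by
    rw [Module.finrank_self, Module.finrank_fin_fun, hE]
  have hloc0 : ∀ θ, IsLocalDiffeomorphAt (𝓘(ℝ, ℝ).prod 𝓘(ℝ, (Fin 3 → ℝ))) I ∞ χ (θ, 0) := fun θ ↦ by
    rw [hχ_eq]
    exact isLocalDiffeomorphAt_framedExp_zero (cov := cov) hk hfield (hinj0 θ) hdim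
  -- (4) a uniform tube of local diffeomorphism points (tube lemma over `[0, T]`, then periods)
  set G : Set (ℝ × (Fin 3 → ℝ)) :=
    {q | IsLocalDiffeomorphAt (𝓘(ℝ, ℝ).prod 𝓘(ℝ, (Fin 3 → ℝ))) I ∞ χ q} with hG
  have hGopen : IsOpen G := by
    refine isOpen_iff_mem_nhds.2 fun q hq ↦ ?_
    obtain ⟨Φ, hqΦ, heq⟩ := hq
    exact mem_of_superset (Φ.open_source.mem_nhds hqΦ) fun q' hq' ↦ ⟨Φ, hq', heq⟩
  have hsub : Icc 0 T ×ˢ ({0} : Set (Fin 3 → ℝ)) ⊆ G := by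
    rintro ⟨θ, x⟩ ⟨-, hx⟩
    rw [mem_singleton_iff] at hx
    subst hx
    exact hloc0 θ
  obtain ⟨u, v, -, hv, hIu, h0v, huv⟩ :=
    generalized_tube_lemma isCompact_Icc isCompact_singleton hGopen hsub
  obtain ⟨r₁, hr₁, hball⟩ := Metric.isOpen_iff.1 hv 0 (h0v rfl)
  have hGr : ∀ q : ℝ × (Fin 3 → ℝ), ‖q.2‖ < r₁ → q ∈ G := by
    rintro ⟨θ, x⟩ hx
    -- reduce `θ` to `[0, T)` by a period translation
    set k := toIcoDiv hT 0 θ with hk'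
    have hθ' : θ - k • T ∈ Ico 0 T := sub_toIcoDiv_zsmul_mem_Ico hT θ
    have hmem : (θ - k • T, x) ∈ G :=
      huv ⟨hIu (Ico_subset_Icc_self hθ'), hball (by simpa using hx)⟩
    have hcomp : χ = χ ∘ fun q : ℝ × (Fin 3 → ℝ) ↦ (q.1 + -(k • T), q.2) := by
      funext q
      simp only [comp_apply]
      have h := hχperZ (q.1 + -(k • T)) q.2 k
      rw [show q.1 + -(k • T) + k • T = q.1 by ring] at h
      exact h
    show IsLocalDiffeomorphAt (𝓘(ℝ, ℝ).prod 𝓘(ℝ, (Fin 3 → ℝ))) I ∞ χ (θ, x)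
    rw [hcomp]
    refine IsLocalDiffeomorphAt.comp (K := I) (P := M) (g := χ)
      (hf := isLocalDiffeomorphAt_translate (-(k • T)) (θ, x)) ?_
    have : (θ + -(k • T), x) = (θ - k • T, x) := by rw [← sub_eq_add_neg]
    rw [this]
    exact hmem
  -- (5) injectivity modulo the period on a uniform tube
  have hcontAxis : ∀ θ : ℝ, ContinuousAt χ (θ, 0) := fun θ ↦ (hloc0 θ).contMDiffAt.continuousAt
  have hinjAxis : ∀ θ θ' : ℝ, χ (θ, 0) = χ (θ', 0) → ∃ k : ℤ, θ' = θ + k * T := by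
    intro θ θ' h
    rw [hχ0, hχ0] at h
    exact hinjT θ θ' h
  have hlocAxis : ∀ θ : ℝ, ∃ U ∈ 𝓝 ((θ, 0) : ℝ × (Fin 3 → ℝ)), InjOn χ U := by
    intro θ
    obtain ⟨Φ, hqΦ, heq⟩ := hloc0 θ
    exact ⟨Φ.source, Φ.open_source.mem_nhds hqΦ, fun a ha b hb hab ↦
      Φ.injOn ha hb (by rw [← heq ha, ← heq hb]; exact hab)⟩
  obtain ⟨r₂, hr₂, hinj⟩ := exists_radius_injOn_mod_period (g := χ) hT hχper hcontAxis
    hinjAxis hlocAxis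
  -- (6) assemble
  refine ⟨ν, min r₁ r₂, hon, hsm, hν0, hνper, lt_min hr₁ hr₂, fun θ x ↦ hχper θ x, hχ0, hdχ0,
    fun q hq ↦ ?_, fun θ θ' x x' hx hx' h ↦ ?_⟩
  · have hq' : q ∈ G := hGr q (lt_of_lt_of_le hq (min_le_left _ _))
    refine ⟨hq'.contMDiffAt, ?_⟩
    exact (hq'.mfderivToContinuousLinearEquiv (by simp)).injective
  · exact hinj θ θ' x x' (lt_of_lt_of_le hx (min_le_right _ _))
      (lt_of_lt_of_le hx' (min_le_right _ _)) h

end Literature.Geometry.Riemannian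

end
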